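import Summits.AtomisticToContinuum.HydrodynamicLimit.Theorems.ImplosionDichotomyHydroLimitInBandCubicChannelSPrelim
import Summits.AtomisticToContinuum.HydrodynamicLimit.Theorems.ImplosionDichotomyHydroLimitInBandSignedBandDefs
import Summits.AtomisticToContinuum.HydrodynamicLimit.Theorems.OneFlightGossipEngineClampedTransferDockCubicChannelRate
import HarnessLib

/-!
# The SIGNED rate cubic channel in expectation under the true law (stub `stub_cubicChannelRateS`, line `IdeatorOneSketch`,
# crux `HydroLimitInBand`, stmt-AtomisticToContinuum-9133, skeleton v16)

Registered stub `stub_cubicChannelRateS : CubicChannelRateS` (statement in `ImplosionDichotomyHydroLimitInBandSignedBandDefs.lean`).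
Skeleton v16 re-threads the landed rate dock `ClampedTransferDockSketch.clampedTransferDock_of_inputs` (p140743) around its refuted
band input `BandCoherenceLDAlongFamilies` (stmt-17700; Galilean-boost witness): the TEMPLATE of this file is the landed
`ClampedTransferDockCubicRate.stub_cubicChannelRate` (`Theorems/OneFlightGossipEngineClampedTransferDockCubicChannelRate.lean`), whose
thresholds, reference family and top treatment are kept, while the BAND is paid SIGNED (repair R1 of crux-ideate 17700 k2, the
Nachtergaele–Yau momentum truncation):

* pointwise, the suprathermal heat-flux remainder `hi_s = (b_s·w)(|w|² − 5θ_s − G_s(x,|w|²))` splits as the re-orthogonalised band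
  member `F_b = (b_s·w) G_b(x,|w|²)` of `BandShiftStatics` (level `K₁`, rate `c`) plus a remainder
  `≤ Bb C_R 1{K₁ < |w|}|w|³ + A₁ e^{-cK₁}` (`C_R = 1 + 5θM + C_G`);
* the band member over the window is paid by the TWO-SIDED entropy inequality w.r.t. the local reference `ψ_s`
  (`HydroLimitInBandCubicChannelS.signedWindow_expectation`, landed prelim) at the tilt `β = β₀/(C_B K₁)`, its two reference
  exponential moments being the instances of KCWF-Q (`KineticCurrentsLDAlongFamiliesQ`, class-uniform tilt) along the explicit
  reference family clamped to `[0, t]` for the class member `A = 0`, `b = ∇θ/(2θ²)`, `G = G_b` (growth constant `C_B K₁`):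
  `E_λ|∫ Σ F_b| ≤ (w C_B K₁/β₀)(H_N(s) + log 2 + e₁(N+1))`;
* the top cube above `K₁ ≥ 2U` is a lab-frame cubic tail (`top_cube_le`), paid by Tonelli and SEET at rate `2c`, level `K₁ − U`
  (`cubicTailWindow`), exactly as in the template.
Constants: `K⋆ = 1`, `B = C_B/β₀`, `A = 8 Bb C_R + A₁`, `K₀ = max(K₀ˢ(2c), K₀ᵇ(c), 2U) + U + 1`; order of choices
`(slab, θm, clamped families) → C_B → β₀ → B → c ↦ (A₁, K₀) → (K₁, ε) ↦ (G_b, β, e₁, e₃) → τ₀ → N₀(τ)`.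

References: H.-T. Yau, Lett. Math. Phys. 22 (1991) §2; B. Nachtergaele, H.-T. Yau, Comm. Math. Phys. 243 (2003) §5, §7.
prover-line-stmt-AtomisticToContinuum-9133-c17-0 (lead, line cycle 18).
-/

noncomputable section

namespace Summit.AtomisticToContinuum.HydrodynamicLimit.Theorems.HydroLimitInBandCubicChannelS

open scoped BigOperators ENNReal Classical Interval
open MeasureTheory Filter Set Topology InformationTheory
open Literature.MathematicalPhysics.KineticTheory Literature.Analysis.FluidPDE Literature.Analysis.FunctionSpaces
open Summit.AtomisticToContinuum.HydrodynamicLimit.Theses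
open Summit.AtomisticToContinuum.HydrodynamicLimit.Theorems
open Summit.AtomisticToContinuum.HydrodynamicLimit.Theorems.EntropyClockDock (ae_mem_good_localGibbsLaw)
open Summit.AtomisticToContinuum.HydrodynamicLimit.Theorems.ClampedCurrentsDockCubicPathwise (intervalIntegrable_orbit)
open Summit.AtomisticToContinuum.HydrodynamicLimit.Theorems.HydroLimitInBandSignedBand
  (BandShiftStatics KineticCurrentsLDAlongFamiliesQ CubicChannelRateS)

/-! ## The stub -/

open Summit.AtomisticToContinuum.HydrodynamicLimit.Theses.OneFlightGossipEngine
open Summit.AtomisticToContinuum.HydrodynamicLimit.Theorems.ClampedCurrentsDockCubicChannelPrelim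
open Summit.AtomisticToContinuum.HydrodynamicLimit.Theorems.ClampedCurrentsDockCubicChannel (hiF Rrem)
open Summit.AtomisticToContinuum.HydrodynamicLimit.Theorems.ClampedCurrentsDockHeart
  (clampTime clampTime_mem clampTime_of_mem continuous_uncurry_clamp continuousOn_uncurry_of_isSmoothSpaceTimeOn)
open Summit.AtomisticToContinuum.HydrodynamicLimit.Theorems.ClampedTransferDockCubicRate (guard_of_band_min intervalIntegrable_tail)

set_option maxHeartbeats 800000 in -- one declaration: the band statics, KCWF-Q, SEET, the entropy step and the pathwise
-- split are all instantiated against the explicit window functionals of the statement (as the template `stub_cubicChannelRate`)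
/-- **STUB `stub_cubicChannelRateS : CubicChannelRateS`** of line `IdeatorOneSketch` (crux `HydroLimitInBand`, stmt-9133, skeleton v16):
the SIGNED rate cubic channel. The suprathermal heat-flux remainder `hi_s = (b_s·w)(|w|² − 5θ_s − G_s)` of one window is split
pointwise as the re-orthogonalised band member `F_b = (b_s·w) G_b(x, |w|²)` of `BandShiftStatics` (level `K₁`, rate `c`) plus a
remainder `≤ Bb C_R 1{K₁ < |w|}|w|³ + A₁ e^{-cK₁}`; the band member is paid by the two-sided entropy inequality w.r.t. `ψ_s`
(`signedWindow_expectation`) at the tilt `β = β₀/(C_B K₁)`, its two reference exponential moments being the instances of KCWF-Q along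
the explicit reference family clamped to `[0, t]` (class member `A = 0`, `b = ∇θ/(2θ²)`, `G = G_b`, growth constant `C_B K₁`); the top
cube above `K₁ ≥ 2U` is a lab-frame cubic tail paid by Tonelli and SEET at rate `2c`, level `K₁ − U` (`cubicTailWindow`). Constants:
`K⋆ = 1`, `B = C_B/β₀`, `A = 8 Bb C_R + A₁`, `K₀ = max(K₀ˢ(2c), K₀ᵇ(c), 2U) + U + 1`. [cite: Yau1991, §2] -/
theorem stub_cubicChannelRateS : CubicChannelRateS := by
  -- adapted from Theorems/OneFlightGossipEngineClampedTransferDockCubicChannelRate.lean (`stub_cubicChannelRate`, 17615-0):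
  -- thresholds, reference family, top; the band is re-threaded (signed)
  intro hBS _hFS hKQ hSeet r Rf hr hbd hcont
  obtain ⟨η₀K, hη₀K, HKQ⟩ := hKQ
  refine ⟨min (η₀K / 2) r, lt_min (half_pos hη₀K) hr, ?_⟩
  intro a₀ θ₀ u₀ ha hθ hu ha0 hθ0
  obtain ⟨σ₁, hσ₁, hSeetσ⟩ := hSeet a₀ θ₀ u₀ ha hθ hu ha0 hθ0
  refine ⟨min σ₁ (1 / 2), lt_min hσ₁ one_half_pos, ?_⟩
  intro σ hσ hσ0 T ρ θ u hE hguard Φ hT0 t ht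
  have hσ₁' : σ < σ₁ := hσ0.trans_le (min_le_left _ _)
  have hσh : σ < 1 / 2 := hσ0.trans_le (min_le_right _ _)
  have hσ3 : 0 < σ ^ 3 := pow_pos hσ 3
  have hSt := hSeetσ σ hσ hσ₁' T ρ θ u hE Φ hT0 t ht
  refine ⟨1, one_pos, ?_⟩
  intro G C_G hCG hGc hGb hGa hGorth
  -- the slab package of the Euler solution on `[0, t]` and a positive lower temperature bound
  obtain ⟨θM, U, Bb, Lb, hθM, hU, hBb, _hLb, hslab⟩ := slab_package hE ht
  have hIt : Icc 0 t ⊆ Ico 0 T := fun s hs => ⟨hs.1, hs.2.trans_lt ht.2⟩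
  have hθsmI : Torus.IsSmoothSpaceTimeOn (Icc 0 t) θ := hE.smooth_temperature.mono hIt
  have hθconI : ContinuousOn (Function.uncurry θ) (Icc 0 t ×ˢ univ) := continuousOn_uncurry_of_isSmoothSpaceTimeOn hθsmI
  have huconI : ContinuousOn (Function.uncurry u) (Icc 0 t ×ˢ univ) :=
    continuousOn_uncurry_of_isSmoothSpaceTimeOn (hE.smooth_velocity.mono hIt)
  have hbconI : ContinuousOn (Function.uncurry (bfield θ)) (Icc 0 t ×ˢ univ) :=
    continuousOn_uncurry_of_isSmoothSpaceTimeOn ((isSmoothSpaceTimeOn_bfield hE.smooth_temperature hE.temperature_pos).mono hIt)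
  obtain ⟨θm, hθm, hθm'⟩ := ClampedCurrentsDockKineticInstance.exists_pos_le_slab ht.1 hθconI
    (fun s hs => hE.temperature_pos s (hIt hs))
  have h0I : (0 : ℝ) ∈ Icc 0 t := ⟨le_rfl, ht.1⟩
  have hθmM : θm ≤ θM := (hθm' 0 h0I 0).trans ((hslab 0 h0I).2.2.2.2.1 0)
  -- the clamped families (globally jointly continuous)
  have hclm : ∀ s, clampTime t s ∈ Icc 0 t := fun s => clampTime_mem ht.1 s
  have hclI : ∀ s, clampTime t s ∈ Ico 0 T := fun s => hIt (hclm s)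
  have hcl_id : ∀ s ∈ Icc 0 t, clampTime t s = s := fun s hs => clampTime_of_mem hs
  set θc : ℝ → T3 → ℝ := fun s => θ (clampTime t s) with hθc_def
  set uc : ℝ → T3 → V3 := fun s => u (clampTime t s) with huc_def
  set bc : ℝ → T3 → V3 := fun s => bfield θ (clampTime t s) with hbc_def
  set Gc : ℝ → T3 × ℝ → ℝ := fun s => G (clampTime t s) with hGc_def
  have hθcu : Continuous (Function.uncurry θc) := continuous_uncurry_clamp ht.1 hθconI
  have hucu : Continuous (Function.uncurry uc) := continuous_uncurry_clamp ht.1 huconI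
  have hbcu : Continuous (Function.uncurry bc) := continuous_uncurry_clamp ht.1 hbconI
  have hGcu : Continuous (Function.uncurry Gc) :=
    hGc.comp_continuous (((ClampedCurrentsDockHeart.continuous_clampTime t).comp continuous_fst).prodMk continuous_snd)
      fun p => mk_mem_prod (hclm p.1) (mem_univ _)
  have hθmc : ∀ s x, θm ≤ θc s x := fun s x => hθm' _ (hclm s) x
  have hθMc : ∀ s x, θc s x ≤ θM := fun s x => (hslab _ (hclm s)).2.2.2.2.1 x
  have hUc : ∀ s x, ‖uc s x‖ ≤ U := fun s x => (hslab _ (hclm s)).2.2.2.2.2.1 x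
  have hBbc : ∀ s x, ‖bc s x‖ ≤ Bb := fun s x => (hslab _ (hclm s)).2.2.2.2.2.2.1 x
  have hGbc : ∀ (s : ℝ) (y : T3 × ℝ), 0 ≤ y.2 → |Gc s y| ≤ C_G := fun s y hy => hGb _ (hclm s) y hy
  have hGac : ∀ (s : ℝ) (x : T3) (s' : ℝ), s' ≤ 1 → Gc s (x, s') = s' - 5 * θc s x := fun s x s' hs' =>
    hGa _ (hclm s) x s' (by rwa [one_pow])
  have hGorthc : ∀ (s : ℝ) (x : T3) (k : Fin 3),
      ∫ v, ((∑ j : Fin 3, bc s x j * (v - uc s x) j) * Gc s (x, ‖v - uc s x‖ ^ 2)) * v k *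
        localMaxwellian 1 (θc s x) (uc s x) v = 0 := fun s x k => by
    simpa only [hbc_def, bfield_apply] using hGorth _ (hclm s) x k
  -- the band statics along the clamped families
  obtain ⟨CB, hCB, HBS⟩ := hBS θc uc bc Gc θm θM U Bb C_G hθm hθmM hU hBb hCG hθcu hucu hbcu hGcu hθmc hθMc hUc hBbc
    hGbc hGac hGorthc
  have hCB0 : 0 < CB := one_pos.trans_le hCB
  -- the explicit reference family along the solution, clamped to `[0, t]`
  have hmass : ∀ s ∈ Ico 0 T, ∫ x, ρ s x = 1 := fun s hs =>
    (DenseExcursionEverywhere.integral_density_eq hE hs).trans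
      (DenseExcursionEverywhere.integral_density_zero_eq_one hσh.le ha hθ hu ha0 hθ0 Φ hT0)
  have hρc : ∀ s ∈ Ico 0 T, Continuous (ρ s) := fun s hs => (hE.smooth_density.isSmooth_slice hs).continuous
  have hRfI : ∀ s ∈ Ico 0 T, ∀ x, σ ^ 3 * ρ s x ∈ Icc 0 r := fun s hs x =>
    ⟨mul_nonneg hσ3.le (hE.density_pos s hs x).le, by
      rw [mul_comm]; exact ((hguard s hs x).trans_le (min_le_right _ _)).le⟩
  have hac : ∀ s ∈ Ico 0 T, Continuous fun x => ρ s x * Rf (σ ^ 3 * ρ s x) := fun s hs =>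
    (hρc s hs).mul (hcont.comp_continuous (continuous_const.mul (hρc s hs)) (hRfI s hs))
  have ha0' : ∀ s ∈ Ico 0 T, ∀ x, 0 < ρ s x * Rf (σ ^ 3 * ρ s x) := fun s hs x =>
    mul_pos (hE.density_pos s hs x) (one_pos.trans_le (hbd _ (hRfI s hs x)).1)
  have hρu : Continuous (Function.uncurry fun s x => ρ (clampTime t s) x) :=
    continuous_uncurry_clamp ht.1
      ((continuousOn_uncurry_of_isSmoothSpaceTimeOn hE.smooth_density).mono (prod_mono hIt subset_rfl))
  set ac : ℝ → T3 → ℝ := fun s x => ρ (clampTime t s) x * Rf (σ ^ 3 * ρ (clampTime t s) x) with hac_def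
  have hacu : Continuous (Function.uncurry ac) :=
    hρu.mul (hcont.comp_continuous (continuous_const.mul hρu) fun p => hRfI _ (hclI p.1) p.2)
  have hac0 : ∀ s x, 0 < ac s x := fun s x => ha0' _ (hclI s) x
  have hθc0 : ∀ s x, 0 < θc s x := fun s x => hE.temperature_pos _ (hclI s) x
  have hguardB : ∀ s ∈ Icc 0 t, σ ^ 3 * (⨆ x, ac s x) ≤ η₀K * ∫ x, ac s x := fun s _ =>
    guard_of_band_min hbd hσ (hE.density_pos _ (hclI s)) (hmass _ (hclI s))
      (hguard _ (hclI s)) (hρc _ (hclI s)) (hac _ (hclI s))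
  -- KCWF-Q along the clamped reference family: the class-uniform tilt threshold `β₀`
  obtain ⟨β₀, hβ₀, HKβ⟩ := HKQ t ac θc uc hacu hθcu hucu hac0 hθc0 σ hσ hguardB Φ
  -- the band coefficient `B := C_B / β₀`
  refine ⟨CB / β₀, by positivity, fun c hc => ?_⟩
  -- SEET at rate `2c` (the top), the band statics at rate `c`
  obtain ⟨K₀, hK₀, HSK⟩ := hSt (2 * c) (by positivity)
  obtain ⟨A₁, hA₁, K₀b, hK₀b, HBK⟩ := HBS c hc
  set CR : ℝ := 1 + 5 * θM + C_G with hCRdef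
  have hCR : 0 < CR := by positivity
  refine ⟨8 * (Bb * CR) + A₁, by positivity, max (max K₀ K₀b) (2 * U) + U + 1, by positivity, fun K₁ hK₁ ε hε => ?_⟩
  have hK₁U : K₀ ≤ K₁ - U := by linarith [le_max_left (max K₀ K₀b) (2 * U), le_max_left K₀ K₀b]
  have h2U : 2 * U ≤ K₁ := by linarith [le_max_right (max K₀ K₀b) (2 * U)]
  have hK₁b : K₀b ≤ K₁ := by linarith [le_max_left (max K₀ K₀b) (2 * U), le_max_right K₀ K₀b]
  have hK₁1 : (1 : ℝ) ≤ K₁ := hK₀b.trans hK₁b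
  have hK₁0 : 0 ≤ K₁ := zero_le_one.trans hK₁1
  -- the band member of level `K₁`
  obtain ⟨Gb, hGbco, ⟨Mb, hMb⟩, hgrowth, hO0, hO1, hO2, hrem⟩ := HBK K₁ hK₁b
  -- the tilt `β := β₀ / (C_B K₁)` and the small parameters
  have hCK : 0 < CB * K₁ := by positivity
  set β : ℝ := β₀ / (CB * K₁) with hβdef
  have hβ0 : 0 < β := by positivity
  have hβle : |β| * (CB * K₁) ≤ β₀ := by rw [abs_of_pos hβ0, hβdef, div_mul_cancel₀ _ hCK.ne']
  have hβle' : |(-β)| * (CB * K₁) ≤ β₀ := by rwa [abs_neg]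
  set e₁ : ℝ := ε * β / 8 with he₁def
  have he₁ : 0 < e₁ := by positivity
  set e₃ : ℝ := ε / (8 * (8 * (Bb * CR)) + 8) with he₃def
  have he₃ : 0 < e₃ := by positivity
  -- KCWF-Q for the member `A = 0, b = bc, G = G_b` (growth constant `C_B K₁`) at the tilts `± β`, accuracy `e₁`
  have HK := HKβ (fun _ _ _ _ => (0 : ℝ)) bc Gb continuous_const hbcu hGbco
  simp only [zero_mul, Finset.sum_const_zero, zero_add] at HK
  obtain ⟨τ₁, hτ₁, Hτ₁⟩ := HK (CB * K₁) hCK (fun s _ y => hgrowth s y) (fun s _ x => hO0 s x) (fun s _ x j => hO1 s x j)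
    (fun s _ x => hO2 s x) β hβle e₁ he₁
  obtain ⟨τ₂, _hτ₂, Hτ₂⟩ := HK (CB * K₁) hCK (fun s _ y => hgrowth s y) (fun s _ x => hO0 s x) (fun s _ x j => hO1 s x j)
    (fun s _ x => hO2 s x) (-β) hβle' e₁ he₁
  -- the top: SEET at rate `2c`, level `K₁ − U`, accuracy `e₃`
  obtain ⟨N₅, hN₅⟩ := HSK (K₁ - U) hK₁U e₃ he₃
  refine ⟨max τ₁ τ₂, lt_max_of_lt_left hτ₁, fun τ hτ => ?_⟩
  have hτ0 : 0 < τ := hτ₁.trans_le ((le_max_left _ _).trans hτ)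
  obtain ⟨N₁, hN₁⟩ := Hτ₁ τ ((le_max_left _ _).trans hτ)
  obtain ⟨N₂, hN₂⟩ := Hτ₂ τ ((le_max_right _ _).trans hτ)
  -- `N` large enough for the `log 2` of the two-sided step
  obtain ⟨N₄, hN₄⟩ := exists_nat_ge (Real.log 2 / (ε * β / 8))
  refine ⟨max (max N₁ N₂) (max N₄ N₅), fun N hN s hs0 hsw => ?_⟩
  simp only [max_le_iff] at hN
  obtain ⟨⟨hN₁N, hN₂N⟩, hN₄N, hN₅N⟩ := hN
  intro w hi
  have hw : 0 < w := mul_pos hτ0 (Real.rpow_pos_of_pos (by positivity) _)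
  have hsw' : s + w ≤ t := hsw
  have hst : s ≤ t := by linarith
  have hsI : s ∈ Icc 0 t := ⟨hs0, hst⟩
  have hsT : s ∈ Ico 0 T := hIt hsI
  have hN1 : (0 : ℝ) < (N : ℝ) + 1 := by positivity
  have hcls : clampTime t s = s := hcl_id s hsI
  obtain ⟨hθcs, hucs, hbcs, hθpos, _hθle, hule, _hble, -⟩ := hslab s hsI
  have hGsc : Continuous (G s) :=
    hGc.comp_continuous (continuous_const.prodMk continuous_id) fun y => mk_mem_prod hsI (mem_univ _)
  have hGbs : Continuous (Gb s) := hGbco.comp (continuous_const.prodMk continuous_id)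
  -- (1) the band member at time `s` as a one-body functional: continuous and bounded
  set Fb : T3 × V3 → ℝ := fun y => (∑ j : Fin 3, bfield θ s y.1 j * (y.2 - u s y.1) j) * Gb s (y.1, ‖y.2 - u s y.1‖ ^ 2)
    with hFbdef
  have hFbc : Continuous Fb := by
    rw [hFbdef]
    have hb' : ∀ j : Fin 3, Continuous fun x : T3 => bfield θ s x j := fun j =>
      (PiLp.continuous_apply 2 (fun _ : Fin 3 => ℝ) j).comp hbcs
    have hw' : ∀ j : Fin 3, Continuous fun y : T3 × V3 => (y.2 - u s y.1) j := fun j =>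
      (PiLp.continuous_apply 2 (fun _ : Fin 3 => ℝ) j).comp (continuous_snd.sub (hucs.comp continuous_fst))
    have h1 : Continuous fun y : T3 × V3 => ∑ j : Fin 3, bfield θ s y.1 j * (y.2 - u s y.1) j :=
      continuous_finsetSum _ fun j _ => ((hb' j).comp continuous_fst).mul (hw' j)
    have h2 : Continuous fun y : T3 × V3 => Gb s (y.1, ‖y.2 - u s y.1‖ ^ 2) :=
      hGbs.comp (continuous_fst.prodMk ((continuous_snd.sub (hucs.comp continuous_fst)).norm.pow 2))
    exact h1.mul h2
  have hFbb : ∀ y, |Fb y| ≤ Mb := fun y => by simpa only [hFbdef, hbc_def, huc_def, hcls] using hMb s y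
  -- (2) the two reference exponential moments of KCWF-Q at `(N, s)`, read at the solution's slices
  have hK₁' := hN₁ N hN₁N s hsI
  have hK₂' := hN₂ N hN₂N s hsI
  simp only [hac_def, hθc_def, huc_def, hbc_def, hcls] at hK₁' hK₂'
  -- (3) the band member in expectation under the true law: the two-sided entropy step
  have hSW := signedWindow_expectation (Φ N) (F := Fb) (B := e₁ * ((N : ℝ) + 1)) hσ hσh ha hθ hu ha0 hθ0 (hac s hsT) hθcs hucs
    (ha0' s hsT) hθpos hFbc hFbb hs0 hw hβ0 hK₁' hK₂'
  -- (4) the top: cubic tails on the window under the true law (SEET at each time, Tonelli)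
  have hTop : ∀ r' ∈ Icc s (s + w), ∫⁻ z, ENNReal.ofReal (((N : ℝ) + 1)⁻¹ * ∑ i : Fin (N + 1),
      Set.indicator {v : V3 | K₁ - U < ‖v‖} (fun v => ‖v‖ ^ 3) (((Φ N).flow r' z i).2)) ∂(localGibbsLaw σ a₀ u₀ θ₀ N (Φ N)) ≤
      ENNReal.ofReal (Real.exp (-(2 * c * (K₁ - U))) + e₃) := fun r' hr' =>
    hN₅ N hN₅N r' ⟨hs0.trans hr'.1, hr'.2.trans hsw'⟩
  have hT := cubicTailWindow σ N (Φ N) a₀ θ₀ u₀ (K₁ - U) (Real.exp (-(2 * c * (K₁ - U))) + e₃) s w hσ hσh ha hθ hu ha0 hθ0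
    (by positivity) hw.le hTop
  -- (5) the pathwise split on the good set: `hi = F_b + (hi − F_b)`, the remainder by the band statics and the top cube
  have hhic : Continuous (hiF (θ s) (u s) (bfield θ s) (G s)) := by
    have hb' : ∀ j : Fin 3, Continuous fun x : T3 => bfield θ s x j := fun j =>
      (PiLp.continuous_apply 2 (fun _ : Fin 3 => ℝ) j).comp hbcs
    have hw' : ∀ j : Fin 3, Continuous fun y : T3 × V3 => (y.2 - u s y.1) j := fun j =>
      (PiLp.continuous_apply 2 (fun _ : Fin 3 => ℝ) j).comp (continuous_snd.sub (hucs.comp continuous_fst))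
    have h1 : Continuous fun y : T3 × V3 => ∑ j : Fin 3, bfield θ s y.1 j * (y.2 - u s y.1) j :=
      continuous_finsetSum _ fun j _ => ((hb' j).comp continuous_fst).mul (hw' j)
    have hn : Continuous fun y : T3 × V3 => ‖y.2 - u s y.1‖ ^ 2 := (continuous_snd.sub (hucs.comp continuous_fst)).norm.pow 2
    have h2 : Continuous fun y : T3 × V3 => Rrem (θ s) (G s) y.1 (‖y.2 - u s y.1‖ ^ 2) := by
      unfold Rrem
      exact (hn.sub ((hθcs.comp continuous_fst).const_mul 5)).sub (hGsc.comp (continuous_fst.prodMk hn))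
    exact h1.mul h2
  have hremy : ∀ y : T3 × V3, |hiF (θ s) (u s) (bfield θ s) (G s) y - Fb y| ≤
      8 * (Bb * CR) * Set.indicator {v : V3 | K₁ - U < ‖v‖} (fun v => ‖v‖ ^ 3) y.2 + A₁ * Real.exp (-(c * K₁)) := by
    intro y
    have h := hrem s y
    simp only [hbc_def, huc_def, hθc_def, hGc_def, hcls, bfield_apply] at h
    have htop := top_cube_le (v := y.2) (hule y.1) h2U
    have hBC : 0 ≤ Bb * CR := by positivity
    have h' : |hiF (θ s) (u s) (bfield θ s) (G s) y - Fb y| ≤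
        Bb * (1 + 5 * θM + C_G) * (if K₁ < ‖y.2 - u s y.1‖ then ‖y.2 - u s y.1‖ ^ 3 else 0) + A₁ * Real.exp (-(c * K₁)) := by
      simpa only [hiF, Rrem, hFbdef, bfield_apply] using h
    calc _ ≤ _ := h'
      _ ≤ _ := by
        rw [← hCRdef]
        nlinarith [mul_le_mul_of_nonneg_left htop hBC]
  have hpath : ∀ z ∈ (Φ N).good,
      |∫ r in s..(s + w), ∑ i : Fin (N + 1), hiF (θ s) (u s) (bfield θ s) (G s) ((Φ N).flow r z i)| ≤
        0 * (0 : ℝ) + w * ((N : ℝ) + 1) * (A₁ * Real.exp (-(c * K₁))) +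
        8 * (Bb * CR) * (∫ r in s..(s + w), ∑ i : Fin (N + 1),
          Set.indicator {v : V3 | K₁ - U < ‖v‖} (fun v => ‖v‖ ^ 3) (((Φ N).flow r z i).2)) +
        1 * |∫ r in s..(s + w), ∑ i : Fin (N + 1), Fb ((Φ N).flow r z i)| := by
    intro z hz
    have hIhi : IntervalIntegrable (fun r => ∑ i : Fin (N + 1), hiF (θ s) (u s) (bfield θ s) (G s) ((Φ N).flow r z i))
        volume s (s + w) :=
      ClampedCurrentsDockCubicPathwise.intervalIntegrable_fun_sum _ fun i _ => intervalIntegrable_orbit (Φ N) hz hhic i s (s + w)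
    have hIFb : IntervalIntegrable (fun r => ∑ i : Fin (N + 1), Fb ((Φ N).flow r z i)) volume s (s + w) :=
      ClampedCurrentsDockCubicPathwise.intervalIntegrable_fun_sum _ fun i _ => intervalIntegrable_orbit (Φ N) hz hFbc i s (s + w)
    have hIT : IntervalIntegrable (fun r => ∑ i : Fin (N + 1),
        Set.indicator {v : V3 | K₁ - U < ‖v‖} (fun v => ‖v‖ ^ 3) (((Φ N).flow r z i).2)) volume s (s + w) :=
      ClampedCurrentsDockCubicPathwise.intervalIntegrable_fun_sum _ fun i _ => intervalIntegrable_tail (Φ N) hz (K₁ - U) i s (s + w)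
    -- the split of the integrand
    have hsplit : (fun r => ∑ i : Fin (N + 1), hiF (θ s) (u s) (bfield θ s) (G s) ((Φ N).flow r z i)) =
        fun r => (∑ i : Fin (N + 1), Fb ((Φ N).flow r z i)) +
          ∑ i : Fin (N + 1), (hiF (θ s) (u s) (bfield θ s) (G s) ((Φ N).flow r z i) - Fb ((Φ N).flow r z i)) := by
      funext r; rw [← Finset.sum_add_distrib]; exact Finset.sum_congr rfl fun i _ => by ring
    -- the remainder integrand is dominated by the integrable majorant `g`
    have hIg : IntervalIntegrable (fun r => 8 * (Bb * CR) * (∑ i : Fin (N + 1),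
        Set.indicator {v : V3 | K₁ - U < ‖v‖} (fun v => ‖v‖ ^ 3) (((Φ N).flow r z i).2)) +
        ((N : ℝ) + 1) * (A₁ * Real.exp (-(c * K₁)))) volume s (s + w) := (hIT.const_mul _).add intervalIntegrable_const
    have hdom : ∀ r, ‖(∑ i : Fin (N + 1), hiF (θ s) (u s) (bfield θ s) (G s) ((Φ N).flow r z i)) -
        ∑ i : Fin (N + 1), Fb ((Φ N).flow r z i)‖ ≤ 8 * (Bb * CR) * (∑ i : Fin (N + 1),
        Set.indicator {v : V3 | K₁ - U < ‖v‖} (fun v => ‖v‖ ^ 3) (((Φ N).flow r z i).2)) +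
        ((N : ℝ) + 1) * (A₁ * Real.exp (-(c * K₁))) := by
      intro r
      rw [Real.norm_eq_abs, ← Finset.sum_sub_distrib]
      refine (Finset.abs_sum_le_sum_abs _ _).trans ?_
      calc ∑ i : Fin (N + 1), |hiF (θ s) (u s) (bfield θ s) (G s) ((Φ N).flow r z i) - Fb ((Φ N).flow r z i)|
          ≤ ∑ i : Fin (N + 1), (8 * (Bb * CR) * Set.indicator {v : V3 | K₁ - U < ‖v‖} (fun v => ‖v‖ ^ 3) ((Φ N).flow r z i).2 +
              A₁ * Real.exp (-(c * K₁))) := Finset.sum_le_sum fun i _ => hremy _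
        _ = _ := by
          rw [Finset.sum_add_distrib, ← Finset.mul_sum, Finset.sum_const, Finset.card_univ, Fintype.card_fin, nsmul_eq_mul]
          push_cast; ring
    have hsub : (∫ r in s..(s + w), ∑ i : Fin (N + 1), hiF (θ s) (u s) (bfield θ s) (G s) ((Φ N).flow r z i)) =
        (∫ r in s..(s + w), ∑ i : Fin (N + 1), Fb ((Φ N).flow r z i)) +
          ∫ r in s..(s + w), ((∑ i : Fin (N + 1), hiF (θ s) (u s) (bfield θ s) (G s) ((Φ N).flow r z i)) -
            ∑ i : Fin (N + 1), Fb ((Φ N).flow r z i)) := by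
      rw [intervalIntegral.integral_sub hIhi hIFb]; ring
    have hrest : |∫ r in s..(s + w), ((∑ i : Fin (N + 1), hiF (θ s) (u s) (bfield θ s) (G s) ((Φ N).flow r z i)) -
        ∑ i : Fin (N + 1), Fb ((Φ N).flow r z i))| ≤ ∫ r in s..(s + w), (8 * (Bb * CR) * (∑ i : Fin (N + 1),
        Set.indicator {v : V3 | K₁ - U < ‖v‖} (fun v => ‖v‖ ^ 3) (((Φ N).flow r z i).2)) +
        ((N : ℝ) + 1) * (A₁ * Real.exp (-(c * K₁)))) := by
      have h := intervalIntegral.norm_integral_le_of_norm_le (le_add_of_nonneg_right hw.le)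
        (Eventually.of_forall fun r _ => hdom r) hIg
      rwa [Real.norm_eq_abs] at h
    have hgint : (∫ r in s..(s + w), (8 * (Bb * CR) * (∑ i : Fin (N + 1),
        Set.indicator {v : V3 | K₁ - U < ‖v‖} (fun v => ‖v‖ ^ 3) (((Φ N).flow r z i).2)) +
        ((N : ℝ) + 1) * (A₁ * Real.exp (-(c * K₁))))) = 8 * (Bb * CR) * (∫ r in s..(s + w), ∑ i : Fin (N + 1),
        Set.indicator {v : V3 | K₁ - U < ‖v‖} (fun v => ‖v‖ ^ 3) (((Φ N).flow r z i).2)) +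
        w * ((N : ℝ) + 1) * (A₁ * Real.exp (-(c * K₁))) := by
      rw [intervalIntegral.integral_add (hIT.const_mul _) intervalIntegrable_const, intervalIntegral.integral_const_mul,
        intervalIntegral.integral_const, smul_eq_mul]
      ring
    rw [hsub]
    calc _ ≤ |∫ r in s..(s + w), ∑ i : Fin (N + 1), Fb ((Φ N).flow r z i)| + |∫ r in s..(s + w),
          ((∑ i : Fin (N + 1), hiF (θ s) (u s) (bfield θ s) (G s) ((Φ N).flow r z i)) - ∑ i : Fin (N + 1), Fb ((Φ N).flow r z i))| :=
          abs_add_le _ _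
      _ ≤ _ := by rw [hgint] at hrest; linarith
  -- (6) in mean: the one possibly non-measurable term (the band window functional) is integrated last
  have hTm : AEMeasurable (fun z => ∫ r in s..(s + w), ∑ i : Fin (N + 1),
      Set.indicator {v : V3 | K₁ - U < ‖v‖} (fun v => ‖v‖ ^ 3) (((Φ N).flow r z i).2)) (localGibbsLaw σ a₀ u₀ θ₀ N (Φ N)) :=
    (Φ N).aemeasurable_intervalIntegral_comp_flow_torus (f := tailSum N (K₁ - U)) (measurable_tailSum N (K₁ - U)) s (s + w)
      (mem_ae_iff.1 (ae_mem_good_localGibbsLaw σ a₀ θ₀ u₀ N (Φ N)))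
  haveI := isProbabilityMeasure_localGibbsLaw ha hθ hu ha0 hθ0 hσh.le N (Φ N)
  have hKL0 : 0 ≤ w / β * ((klDiv ((Φ N).lawAt (localGibbsLaw σ a₀ u₀ θ₀ N (Φ N)) s)
      (localGibbsLaw σ (fun x => ρ s x * Rf (σ ^ 3 * ρ s x)) (u s) (θ s) N (Φ N))).toReal + Real.log 2 + e₁ * ((N : ℝ) + 1)) :=
    mul_nonneg (div_nonneg hw.le hβ0.le) (add_nonneg (add_nonneg ENNReal.toReal_nonneg (Real.log_nonneg one_le_two)) (by positivity))
  have hmean := lintegral_abs_le_of_pathwise (P := localGibbsLaw σ a₀ u₀ θ₀ N (Φ N))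
    (X := fun z => ∫ r in s..(s + w), ∑ i : Fin (N + 1), hiF (θ s) (u s) (bfield θ s) (G s) ((Φ N).flow r z i))
    (V := fun _ => (0 : ℝ)) (k₁ := 0) (k₀ := w * ((N : ℝ) + 1) * (A₁ * Real.exp (-(c * K₁)))) (k₃ := 8 * (Bb * CR)) (k₂ := 1)
    (BV := 0) le_rfl (by positivity) (by positivity) zero_le_one le_rfl (by positivity) hKL0 aemeasurable_const hTm
    (by filter_upwards [ae_mem_good_localGibbsLaw σ a₀ θ₀ u₀ N (Φ N)] with z hz using hpath z hz) (by simp) hT hSW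
  refine hmean.trans (ENNReal.ofReal_le_ofReal ?_)
  -- (7) bookkeeping: `w/β = w (B K₁)`, `(w/β) e₁ (N+1) = w(N+1) ε/8`, `(w/β) log 2 ≤ w(N+1) ε/8`, `8BbC_R e₃ ≤ ε/8`, the top rate
  set KL : ℝ := (klDiv ((Φ N).lawAt (localGibbsLaw σ a₀ u₀ θ₀ N (Φ N)) s)
      (localGibbsLaw σ (fun x => ρ s x * Rf (σ ^ 3 * ρ s x)) (u s) (θ s) N (Φ N))).toReal with hKLdef
  set E : ℝ := Real.exp (-(c * K₁)) with hEdef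
  set X₂ : ℝ := Real.exp (-(2 * c * (K₁ - U))) with hX₂def
  have hKL : 0 ≤ KL := ENNReal.toReal_nonneg
  have hwN : 0 ≤ w * ((N : ℝ) + 1) := by positivity
  have hwβ : w / β = w * (CB / β₀ * K₁) := by rw [hβdef]; field_simp
  have h1 : w / β * (e₁ * ((N : ℝ) + 1)) = w * ((N : ℝ) + 1) * (ε / 8) := by rw [he₁def]; field_simp
  have h2 : w / β * Real.log 2 ≤ w * ((N : ℝ) + 1) * (ε / 8) := by
    have hN' : Real.log 2 / (ε * β / 8) ≤ (N : ℝ) + 1 :=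
      (hN₄.trans (by exact_mod_cast hN₄N)).trans (le_add_of_nonneg_right zero_le_one)
    rw [div_le_iff₀ (by positivity)] at hN'
    rw [div_mul_eq_mul_div, div_le_iff₀ hβ0]
    nlinarith [hw.le, hN']
  have h3 : 8 * (Bb * CR) * e₃ ≤ ε / 8 := by rw [he₃def]; exact mul_frac_le (by positivity) hε.le
  have hX : X₂ ≤ E := Real.exp_le_exp.2 (by nlinarith)
  have p3 : w * ((N : ℝ) + 1) * (8 * (Bb * CR) * e₃) ≤ w * ((N : ℝ) + 1) * (ε / 8) := mul_le_mul_of_nonneg_left h3 hwN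
  have pX : w * ((N : ℝ) + 1) * (8 * (Bb * CR) * X₂) ≤ w * ((N : ℝ) + 1) * (8 * (Bb * CR) * E) :=
    mul_le_mul_of_nonneg_left (mul_le_mul_of_nonneg_left hX (by positivity)) hwN
  have hwNε : 0 ≤ w * ((N : ℝ) + 1) * ε := by positivity
  have eq1 : 0 * (0 : ℝ) + w * ((N : ℝ) + 1) * (A₁ * E) + 8 * (Bb * CR) * (w * ((N : ℝ) + 1) * (X₂ + e₃)) +
      1 * (w / β * (KL + Real.log 2 + e₁ * ((N : ℝ) + 1))) =
      w * ((N : ℝ) + 1) * (A₁ * E) + w * ((N : ℝ) + 1) * (8 * (Bb * CR) * X₂) + w * ((N : ℝ) + 1) * (8 * (Bb * CR) * e₃) +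
        w / β * KL + w / β * Real.log 2 + w / β * (e₁ * ((N : ℝ) + 1)) := by ring
  have eq2 : w * ((N : ℝ) + 1) * (ε + (8 * (Bb * CR) + A₁) * E) + w * (CB / β₀ * K₁) * KL =
      w * ((N : ℝ) + 1) * ε + w * ((N : ℝ) + 1) * (8 * (Bb * CR) * E) + w * ((N : ℝ) + 1) * (A₁ * E) + w / β * KL := by
    rw [hwβ]; ring
  rw [eq1, eq2, h1]
  linarith [h2, p3, pX, hwNε]

end Summit.AtomisticToContinuum.HydrodynamicLimit.Theorems.HydroLimitInBandCubicChannelS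

end
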